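import Summits.PneNP.PneNP.Theorems.ConvexRankGatesConvexGateBlindStubPerfectCompletenessFunctional

/-!
# Sum-of-squares positivity of Grigoriev's functional
(helper for stub `stub_perfectCompleteness` of line `xor-door-perfect-completeness`, crux `ConvexGateBlind`,
item stmt-PneNP-10680; registered sub-goal `stub_perfectCompleteness_sos`)

Continuation of `…StubPerfectCompletenessFunctional`: under `IsoHyp A K d`, for every real function `s`
on `𝔽₂^m` whose Walsh coefficients live on sets of size `≤ k` with `2k ≤ d`,
`Ẽ (s²) = ∑_{S,S'} ŝ(S) ŝ(S') e(S ∆ S') ≥ 0` (Grigoriev 2001, §2; Schoenebeck 2008, Thm 1, the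
"Lasserre survives" half). Proof: "`S ∆ S'` determined" is an equivalence relation on the low sets
(transitivity by `IsoHyp.e_mul`, since `#(S' ∆ S'') ≤ 2k ≤ d`), `e(S ∆ S') = η(S) η(S')` inside a class
with `η(S) = e(S ∆ rep)` for a chosen representative, and `e(S ∆ S') = 0` across classes, so the
double sum is a sum over classes of squares (`sum_sum_ite_key_nonneg`).
-/

set_option linter.dupNamespace false -- `Summit.PneNP.PneNP.…`: summit = sub-problem (D-0017)

namespace Summit.PneNP.PneNP.Theorems.XorDoor.PC

open Finset

noncomputable section

variable {m : ℕ} {V : Type*}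

/-! ### Block-diagonal Gram sums -/

/-- A block-diagonal Gram sum is non-negative:
`∑_{S, S' ∈ D, key S = key S'} b(S) b(S') = ∑_C (∑_{key S = C} b(S))² ≥ 0`. [folklore] -/
theorem sum_sum_ite_key_nonneg {ι κ : Type*} [DecidableEq κ] (D : Finset ι) (key : ι → κ)
    (b : ι → ℝ) : 0 ≤ ∑ S ∈ D, ∑ S' ∈ D, if key S' = key S then b S * b S' else 0 := by
  have h : ∑ S ∈ D, ∑ S' ∈ D, (if key S' = key S then b S * b S' else 0) =
      ∑ C ∈ D.image key, (∑ S ∈ D with key S = C, b S) * ∑ S ∈ D with key S = C, b S := by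
    rw [← sum_fiberwise_of_maps_to (g := key) (fun S hS => mem_image_of_mem key hS)]
    refine sum_congr rfl fun C _ => ?_
    rw [sum_mul]
    refine sum_congr rfl fun S hS => ?_
    rw [mem_filter] at hS
    rw [hS.2, mul_sum, sum_filter]
  rw [h]
  exact sum_nonneg fun C _ => mul_self_nonneg _

/-! ### Low-degree index sets, classes, representatives -/

/-- The index sets of size at most `k`. [folklore] -/
def lowSets (m k : ℕ) : Finset (Finset (Fin m)) := univ.filter fun S => S.card ≤ k

/-- Membership in `lowSets`. [folklore] -/
@[simp] theorem mem_lowSets {k : ℕ} {S : Finset (Fin m)} : S ∈ lowSets m k ↔ S.card ≤ k := by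
  simp [lowSets]

open scoped Classical in
/-- The class of `S`: the low sets `S'` with `S ∆ S'` determined. [folklore] -/
def cls (A : V → Finset (Fin m)) (K k : ℕ) (S : Finset (Fin m)) : Finset (Finset (Fin m)) :=
  (lowSets m k).filter fun S' => Det A K (symmDiff S S')

/-- Membership in a class. [folklore] -/
theorem mem_cls {A : V → Finset (Fin m)} {K k : ℕ} {S S' : Finset (Fin m)} :
    S' ∈ cls A K k S ↔ S'.card ≤ k ∧ Det A K (symmDiff S S') := by
  classical
  unfold cls
  rw [mem_filter, mem_lowSets]

/-- A chosen element of a family of sets (`∅` for the empty family). [folklore] -/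
def rep (C : Finset (Finset (Fin m))) : Finset (Fin m) :=
  if hC : C.Nonempty then hC.choose else ∅

/-- The chosen element lies in a nonempty family. [folklore] -/
theorem rep_mem {C : Finset (Finset (Fin m))} (hC : C.Nonempty) : rep C ∈ C := by
  unfold rep
  rw [dif_pos hC]
  exact hC.choose_spec

/-- The sign of `S` relative to the representative of its class: `η(S) = e(S ∆ rep [S])`.
[folklore] -/
def eta (A : V → Finset (Fin m)) (c : V → ZMod 2) (K k : ℕ) (S : Finset (Fin m)) : ℝ :=
  e A c K (symmDiff S (rep (cls A K k S)))

/-- A low set lies in its own class. [folklore] -/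
theorem self_mem_cls {A : V → Finset (Fin m)} {K k : ℕ} {S : Finset (Fin m)} (hS : S.card ≤ k) :
    S ∈ cls A K k S := by
  rw [mem_cls, symmDiff_self, Finset.bot_eq_empty]
  exact ⟨hS, det_empty A K⟩

/-- Unrelated low sets have different classes. [folklore] -/
theorem cls_ne {A : V → Finset (Fin m)} {K k : ℕ} {S S' : Finset (Fin m)} (hS' : S'.card ≤ k)
    (hr : ¬ Det A K (symmDiff S S')) : cls A K k S ≠ cls A K k S' := by
  intro heq
  have h1 : S' ∈ cls A K k S := heq ▸ self_mem_cls hS'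
  exact hr (mem_cls.1 h1).2

/-! ### Sum-of-squares positivity -/

variable [Fintype V] [DecidableEq V] {A : V → Finset (Fin m)} {K d : ℕ}

/-- Transitivity of "`S ∆ S'` is determined" on low sets (`2k ≤ d`), with the product rule for `e`.
[folklore] -/
theorem IsoHyp.det_trans (h : IsoHyp A K d) (c : V → ZMod 2) {k : ℕ} (hk : 2 * k ≤ d)
    {S S' S'' : Finset (Fin m)} (hS' : S'.card ≤ k) (hS'' : S''.card ≤ k)
    (h1 : Det A K (symmDiff S S')) (h2 : Det A K (symmDiff S S'')) :
    Det A K (symmDiff S' S'') ∧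
      e A c K (symmDiff S' S'') = e A c K (symmDiff S S') * e A c K (symmDiff S S'') := by
  have hXY : symmDiff (symmDiff S S') (symmDiff S S'') = symmDiff S' S'' := by
    rw [symmDiff_comm S S', symmDiff_assoc, symmDiff_symmDiff_cancel_left]
  have hd : (symmDiff (symmDiff S S') (symmDiff S S'')).card ≤ d := by
    rw [hXY]
    have : (symmDiff S' S'').card ≤ S'.card + S''.card :=
      (card_le_card symmDiff_subset_union).trans (card_union_le _ _)
    omega
  have h3 := h.e_mul c h1 h2 hd
  rwa [hXY] at h3

/-- Related low sets have the same class. [folklore] -/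
theorem IsoHyp.cls_eq (h : IsoHyp A K d) {k : ℕ} (hk : 2 * k ≤ d) {S S' : Finset (Fin m)}
    (hS : S.card ≤ k) (hS' : S'.card ≤ k) (hr : Det A K (symmDiff S S')) :
    cls A K k S = cls A K k S' := by
  ext T
  rw [mem_cls, mem_cls]
  constructor
  · rintro ⟨hT, hST⟩
    exact ⟨hT, (h.det_trans 0 hk hS' hT hr hST).1⟩
  · rintro ⟨hT, hS'T⟩
    have hr' : Det A K (symmDiff S' S) := by rwa [symmDiff_comm]
    exact ⟨hT, (h.det_trans 0 hk hS hT hr' hS'T).1⟩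

/-- **Factorisation through representatives**: `e(S ∆ S') = η(S) η(S')` for related low sets.
[folklore] -/
theorem IsoHyp.e_symmDiff_eq_eta_mul_eta (h : IsoHyp A K d) (c : V → ZMod 2) {k : ℕ}
    (hk : 2 * k ≤ d) {S S' : Finset (Fin m)} (hS : S.card ≤ k) (hS' : S'.card ≤ k)
    (hr : Det A K (symmDiff S S')) :
    e A c K (symmDiff S S') = eta A c K k S * eta A c K k S' := by
  have hcl : cls A K k S' = cls A K k S := (h.cls_eq hk hS hS' hr).symm
  have hR : rep (cls A K k S) ∈ cls A K k S := rep_mem ⟨S, self_mem_cls hS⟩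
  have hR' : rep (cls A K k S) ∈ cls A K k S' := by
    rw [← hcl]
    exact rep_mem ⟨S', self_mem_cls hS'⟩
  rw [mem_cls] at hR hR'
  unfold eta
  rw [hcl]
  have hrS : Det A K (symmDiff (rep (cls A K k S)) S) := by rw [symmDiff_comm]; exact hR.2
  have hrS' : Det A K (symmDiff (rep (cls A K k S)) S') := by rw [symmDiff_comm]; exact hR'.2
  have h3 := (h.det_trans c hk hS hS' hrS hrS').2
  rwa [symmDiff_comm (rep _) S, symmDiff_comm (rep _) S'] at h3

/-- **Sum-of-squares positivity.** `Ẽ (s²) ≥ 0` whenever `ŝ` is supported on sets of size `≤ k`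
with `2k ≤ d`: grouping `S, S'` by classes, `Ẽ (s²) = ∑_C (∑_{S ∈ C} ŝ(S) η(S))² ≥ 0`. [folklore] -/
theorem IsoHyp.func_mul_self_nonneg (h : IsoHyp A K d) (c : V → ZMod 2) {k : ℕ} (hk : 2 * k ≤ d)
    {s : (Fin m → ZMod 2) → ℝ} (hs : ∀ T : Finset (Fin m), k < T.card → coeff s T = 0) :
    0 ≤ func A c K (s * s) := by
  rw [func_mul_self]
  have hz : ∀ S : Finset (Fin m), S ∉ lowSets m k → coeff s S = 0 := fun S hS =>
    hs S (by rw [mem_lowSets] at hS; omega)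
  have h1 : ∑ S ∈ lowSets m k, ∑ S' ∈ lowSets m k, coeff s S * coeff s S' * e A c K (symmDiff S S')
      = ∑ S, ∑ S', coeff s S * coeff s S' * e A c K (symmDiff S S') := by
    rw [sum_subset (subset_univ (lowSets m k)) fun S _ hS => by simp [hz S hS]]
    exact sum_congr rfl fun S _ => sum_subset (subset_univ _) fun S' _ hS' => by simp [hz S' hS']
  have hpt : ∀ S ∈ lowSets m k, ∀ S' ∈ lowSets m k,
      coeff s S * coeff s S' * e A c K (symmDiff S S') =
        if cls A K k S' = cls A K k S then
          (coeff s S * eta A c K k S) * (coeff s S' * eta A c K k S') else 0 := by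
    intro S hS S' hS'
    rw [mem_lowSets] at hS hS'
    by_cases hr : Det A K (symmDiff S S')
    · rw [if_pos (h.cls_eq hk hS hS' hr).symm, h.e_symmDiff_eq_eta_mul_eta c hk hS hS' hr]
      ring
    · rw [if_neg (fun h' => cls_ne hS' hr h'.symm), e_eq_zero hr, mul_zero]
  rw [← h1, sum_congr rfl fun S hS => sum_congr rfl fun S' hS' => hpt S hS S' hS']
  exact sum_sum_ite_key_nonneg (lowSets m k) (cls A K k) _

/-- Registered sub-goal `stub_perfectCompleteness_sos` of stub `stub_perfectCompleteness`: sum-of-squares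
positivity of Grigoriev's functional under the isoperimetric hypotheses. [folklore] -/
theorem stub_perfectCompleteness_sos : ∀ {m : ℕ} {V : Type} [Fintype V] [DecidableEq V]
    {A : V → Finset (Fin m)} {K d : ℕ}, IsoHyp A K d → ∀ (c : V → ZMod 2) {k : ℕ}, 2 * k ≤ d →
    ∀ {s : (Fin m → ZMod 2) → ℝ}, (∀ T : Finset (Fin m), k < T.card → coeff s T = 0) →
    0 ≤ func A c K (s * s) :=
  fun h c _ hk _ hs => h.func_mul_self_nonneg c hk hs

end

end Summit.PneNP.PneNP.Theorems.XorDoor.PC
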